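import Summits.ValiantsHypothesis.ValiantsHypothesis.Theorems.LacunarySymmetroidMatrixDescartesPivotResolventRolle

/-!
# `MatrixDescartes` census — the CURVATURE REDUCTION for `2 × 2` pivot pencils
# (`Z₊(Φ) ≤ Z₊(τ_e·𝒦·E) + 1` for the critical polynomial `Φ`, `𝒦 = τ_e π_ee − τ_ee π_e` the curvature Wronskian)

HONEST FRAMING.  Object-search cell `pub-symmetroid`, seat `val-sym-mdr-p1` (generation 20); helper file `--supports` the crux item
stmt-ValiantsHypothesis-18050 (`Theses.LacunarySymmetroid.MatrixDescartes`, OPEN, on HOLD) with NO closure claim.  An INSTRUMENT for the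
structural route to «rank-one (2,4)₁ = 8» (last open piece: chamber (C) of the `1|3` split, `…PivotRankOneReductionOneThree`): a
REDUCTION theorem beside the crux; nothing here bears on `MatrixDescartes` in its window, on `DoorA26` / `DoorA34`, registers /
credences, or `VP ≠ VNP`.

SETTING (`…PivotResolventRolle`).  For `δ ∈ ℝ`, `e ∈ ℕ`, `τ, π ∈ ℝ[X]` put `τ_e = Xτ′ − eτ`, `π_e = Xπ′ − 2eπ` (Euler derivatives of
weights `e`, `2e`), and `Φ = δπ_e² + ττ_eπ_e − πτ_e²` — the CRITICAL POLYNOMIAL, whose positive roots contain the critical points of the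
resolvent profile `R(x)/x^e` of every `2 × 2` pivot pencil `X^e J + G` (`det J = −δ`), so that `Z₊(det F) ≤ Z₊(Φ) + 1`
(`card_posRoots_le_one_add_of_resolvent`).  Iterate the Euler derivatives: `τ_ee = Xτ_e′ − eτ_e`, `π_ee = Xπ_e′ − 2eπ_e`, and put

  `𝒦 := τ_e·π_ee − τ_ee·π_e`  (the CURVATURE WRONSKIAN),   `E := 2δπ_e + ττ_e = ½·(X D′ − 2e D)`,  `D = τ² + 4δπ`.

§1 **CURVATURE IDENTITY** (`euler_criticalPoly_mul_sub`, pure algebra): `(XΦ′ − 4eΦ)·τ_e − 2τ_ee·Φ = 𝒦·E` for ALL `τ, π`.  Reading: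
`d/dx [Φ/(x^{2e}τ_e²)] = 𝒦·E/(x^{2e+1}τ_e³)`, so between consecutive positive roots of `τ_e·𝒦·E` the critical polynomial is a MONOTONE
multiple of `x^{2e}τ_e²`.  (Geometry: in the plane of the two resolvent invariants `(R, V) = (−τ/(2x^e), π/x^{2e})` the level sets of the
window profile are straight lines, critical points are tangencies, and a line field is tangent to an inflection-free arc at most once;
`𝒦` is the inflection polynomial of the curve `x ↦ (R, V)`, `E` the Euler derivative of the discriminant.)
§2 **CURVATURE REDUCTION** (`card_posRoots_criticalPoly_le_curvature`): if `τ_e` and `Φ` have no common positive root and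
`τ_e·𝒦·E ≠ 0`, then **`Z₊(Φ) ≤ Z₊(τ_e·𝒦·E) + 1`** — Rolle (the tree's `card_posRoots_le_card_posRoots_add_one`) applied to the bounded
smooth profile `Φ/√(Φ² + x^{4e}τ_e⁴)`, whose positive critical points are roots of `τ_e·𝒦·E` by §1.  With
`card_posRoots_le_one_add_of_resolvent`: **`Z₊(det F) ≤ Z₊(τ_e) + Z₊(𝒦) + Z₊(E) + 2`** (`card_posRoots_mul3_le`).
USE (chamber (C), seat memo CURVATURE.md): for four CORE rank-one letters on the `1|3` split `τ_e` and `E` have one sign change each, so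
`Z₊(det F) ≤ Z₊(𝒦) + 4`; `𝒦` is an explicit 16-nomial and LOCATED `Z₊(𝒦) ≤ 4` on the whole split (Descartes allows 6–12): «(C) ≤ 8»
is thereby REDUCED to «`Z₊(𝒦) ≤ 4`», which is NOT proved here.

[folklore] Rolle's theorem via the tree's `Pivot.Resolvent.card_posRoots_le_card_posRoots_add_one`; chain rule (Mathlib `HasDerivAt`).
No definitions, no named facts.
-/

-- `Summit.ValiantsHypothesis.ValiantsHypothesis.…` repeats a component by the D-0017 layout
-- (single-conjunct summit), which the `dupNamespace` linter flags; the name is mandated.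
set_option linter.dupNamespace false

namespace Summit.ValiantsHypothesis.ValiantsHypothesis.Theorems.LacunarySymmetroidMatrixDescartes.Pivot.Resolvent

open Polynomial Finset Set
open scoped BigOperators

/-! ## 1. The curvature identity -/

/-- **Jet form of the curvature identity** (pure ring algebra in the six jet values `τ, τ_e, τ_ee, π, π_e, π_ee`): with
`Φ = δπ_e² + ττ_eπ_e − πτ_e²` and its Euler derivative `Φ_e = 2δπ_eπ_ee + ττ_eeπ_e + ττ_eπ_ee − 2πτ_eτ_ee` one has
`Φ_e·τ_e − 2τ_ee·Φ = (τ_eπ_ee − τ_eeπ_e)·(2δπ_e + ττ_e)`. [folklore] -/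
theorem curvature_jet_identity (δ T Te Tee P Pe Pee : ℝ) :
    (2 * δ * Pe * Pee + T * Tee * Pe + T * Te * Pee - 2 * P * Te * Tee) * Te
        - 2 * Tee * (δ * Pe ^ 2 + T * Te * Pe - P * Te ^ 2)
      = (Te * Pee - Tee * Pe) * (2 * δ * Pe + T * Te) := by
  ring

/-- **Euler derivative of the critical polynomial, evaluated.**  With `τ_e = Xτ′ − eτ`, `π_e = Xπ′ − 2eπ`, `τ_ee = Xτ_e′ − eτ_e`,
`π_ee = Xπ_e′ − 2eπ_e` and `Φ = δπ_e² + ττ_eπ_e − πτ_e²`:  `x·Φ′(x) − 4e·Φ(x) = 2δπ_eπ_ee + ττ_eeπ_e + ττ_eπ_ee − 2πτ_eτ_ee` (at `x`).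
[folklore: Leibniz rule; the weight-`4e` Euler terms cancel] -/
theorem eval_euler_criticalPoly (δ : ℝ) (e : ℕ) (τ π τe πe τee πee Φ : ℝ[X])
    (hτe : τe = X * derivative τ - Polynomial.C (e : ℝ) * τ) (hπe : πe = X * derivative π - Polynomial.C (2 * (e : ℝ)) * π)
    (hτee : τee = X * derivative τe - Polynomial.C (e : ℝ) * τe) (hπee : πee = X * derivative πe - Polynomial.C (2 * (e : ℝ)) * πe)
    (hΦ : Φ = Polynomial.C δ * πe ^ 2 + τ * τe * πe - π * τe ^ 2) (x : ℝ) :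
    x * Φ.derivative.eval x - 4 * e * Φ.eval x
      = 2 * δ * πe.eval x * πee.eval x + τ.eval x * τee.eval x * πe.eval x + τ.eval x * τe.eval x * πee.eval x
        - 2 * π.eval x * τe.eval x * τee.eval x := by
  subst hΦ hτee hπee
  subst hτe hπe
  simp only [eval_add, eval_sub, eval_mul, eval_pow, eval_C, eval_X, derivative_add, derivative_sub, derivative_mul, derivative_C,
    derivative_pow, derivative_X, zero_mul, zero_add, one_mul, Nat.cast_ofNat, Nat.add_one_sub_one, pow_one]
  ring

/-- **THE CURVATURE IDENTITY (evaluated form).**  For all `τ, π ∈ ℝ[X]`, `δ ∈ ℝ`, `e ∈ ℕ` and every real `x`: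
`(x·Φ′(x) − 4e·Φ(x))·τ_e(x) − 2·τ_ee(x)·Φ(x) = 𝒦(x)·E(x)`, where `𝒦 = τ_eπ_ee − τ_eeπ_e` is the curvature Wronskian and
`E = 2δπ_e + ττ_e`. [this file] -/
theorem euler_criticalPoly_mul_sub (δ : ℝ) (e : ℕ) (τ π τe πe τee πee Φ 𝒦 E : ℝ[X])
    (hτe : τe = X * derivative τ - Polynomial.C (e : ℝ) * τ) (hπe : πe = X * derivative π - Polynomial.C (2 * (e : ℝ)) * π)
    (hτee : τee = X * derivative τe - Polynomial.C (e : ℝ) * τe) (hπee : πee = X * derivative πe - Polynomial.C (2 * (e : ℝ)) * πe)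
    (hΦ : Φ = Polynomial.C δ * πe ^ 2 + τ * τe * πe - π * τe ^ 2) (h𝒦 : 𝒦 = τe * πee - τee * πe)
    (hE : E = Polynomial.C (2 * δ) * πe + τ * τe) (x : ℝ) :
    (x * Φ.derivative.eval x - 4 * e * Φ.eval x) * τe.eval x - 2 * τee.eval x * Φ.eval x = 𝒦.eval x * E.eval x := by
  rw [eval_euler_criticalPoly δ e τ π τe πe τee πee Φ hτe hπe hτee hπee hΦ x]
  have hΦx : Φ.eval x = δ * πe.eval x ^ 2 + τ.eval x * τe.eval x * πe.eval x - π.eval x * τe.eval x ^ 2 := by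
    rw [hΦ]; simp only [eval_add, eval_sub, eval_mul, eval_pow, eval_C]
  have h𝒦x : 𝒦.eval x = τe.eval x * πee.eval x - τee.eval x * πe.eval x := by
    rw [h𝒦]; simp only [eval_sub, eval_mul]
  have hEx : E.eval x = 2 * δ * πe.eval x + τ.eval x * τe.eval x := by
    rw [hE]; simp only [eval_add, eval_mul, eval_C]
  rw [hΦx, h𝒦x, hEx]
  ring

/-! ## 2. The curvature reduction -/

/-- Power bookkeeping: `x · (4e · x^{4e−1}) = 4e · x^{4e}` for every `e : ℕ` (both sides vanish at `e = 0`). [folklore] -/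
theorem mul_pow_pred_eq (x : ℝ) (e : ℕ) : x * ((4 * (e : ℝ)) * x ^ (4 * e - 1)) = (4 * (e : ℝ)) * x ^ (4 * e) := by
  rcases Nat.eq_zero_or_pos e with he | he
  · subst he; simp
  · have h : 4 * e = (4 * e - 1) + 1 := by omega
    conv_rhs => rw [h, pow_succ]
    ring

/-- **THE CURVATURE REDUCTION.**  Let `δ ∈ ℝ`, `e ∈ ℕ`, `τ, π ∈ ℝ[X]`, with the Euler derivatives `τ_e, π_e, τ_ee, π_ee`, the critical
polynomial `Φ = δπ_e² + ττ_eπ_e − πτ_e²`, the curvature Wronskian `𝒦 = τ_eπ_ee − τ_eeπ_e` and `E = 2δπ_e + ττ_e`.  If `Φ` does not vanish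
at the positive roots of `τ_e` and `τ_e·𝒦·E ≠ 0`, then **`Z₊(Φ) ≤ Z₊(τ_e·𝒦·E) + 1`**: the positive critical points of the bounded smooth
profile `ψ(x) = Φ(x)/√(Φ(x)² + x^{4e}τ_e(x)⁴)` (whose positive zeros are the positive roots of `Φ`) are roots of `τ_e·𝒦·E`, because
`x·(Φ′G − ΦG′/2) = x^{4e}τ_e³·((xΦ′ − 4eΦ)τ_e − 2τ_eeΦ) = x^{4e}τ_e³·𝒦·E` for `G = x^{4e}τ_e⁴` (curvature identity), and Rolle's theorem
(`card_posRoots_le_card_posRoots_add_one`) counts. [this file] -/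
theorem card_posRoots_criticalPoly_le_curvature (δ : ℝ) (e : ℕ) (τ π τe πe τee πee Φ 𝒦 E : ℝ[X])
    (hτe : τe = X * derivative τ - Polynomial.C (e : ℝ) * τ) (hπe : πe = X * derivative π - Polynomial.C (2 * (e : ℝ)) * π)
    (hτee : τee = X * derivative τe - Polynomial.C (e : ℝ) * τe) (hπee : πee = X * derivative πe - Polynomial.C (2 * (e : ℝ)) * πe)
    (hΦ : Φ = Polynomial.C δ * πe ^ 2 + τ * τe * πe - π * τe ^ 2) (h𝒦 : 𝒦 = τe * πee - τee * πe)
    (hE : E = Polynomial.C (2 * δ) * πe + τ * τe)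
    (hgen : ∀ x, 0 < x → τe.eval x = 0 → Φ.eval x ≠ 0) (hne : τe * 𝒦 * E ≠ 0) :
    (Φ.roots.toFinset.filter (fun t => 0 < t)).card ≤ ((τe * 𝒦 * E).roots.toFinset.filter (fun t => 0 < t)).card + 1 := by
  -- the profile ψ = N/√S with N = Φ, S = Φ² + G, G = x^{4e} τe⁴
  set N : ℝ → ℝ := fun x => Φ.eval x with hN
  set N' : ℝ → ℝ := fun x => Φ.derivative.eval x with hN'
  set G : ℝ → ℝ := fun x => x ^ (4 * e) * (τe.eval x) ^ 4 with hG
  set G' : ℝ → ℝ := fun x => (4 * (e : ℝ) * x ^ (4 * e - 1)) * (τe.eval x) ^ 4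
      + x ^ (4 * e) * (4 * (τe.eval x) ^ 3 * τe.derivative.eval x) with hG'
  set S : ℝ → ℝ := fun x => N x ^ 2 + G x with hS
  set S' : ℝ → ℝ := fun x => 2 * N x * N' x + G' x with hS'
  have hSpos : ∀ x, 0 < x → 0 < S x := by
    intro x hx
    simp only [hS, hN, hG]
    by_cases h0 : τe.eval x = 0
    · have hΦ0 : Φ.eval x ≠ 0 := hgen x hx h0
      have : 0 < (Φ.eval x) ^ 2 := by positivity
      have h2 : 0 ≤ x ^ (4 * e) * (τe.eval x) ^ 4 := by positivity
      linarith
    · have h1 : 0 < x ^ (4 * e) * (τe.eval x) ^ 4 := by positivity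
      nlinarith [sq_nonneg (Φ.eval x)]
  set ψ : ℝ → ℝ := fun x => N x / Real.sqrt (S x) with hψ
  set ψ' : ℝ → ℝ := fun x => (N' x * Real.sqrt (S x) - N x * (S' x / (2 * Real.sqrt (S x)))) / (Real.sqrt (S x)) ^ 2 with hψ'
  refine card_posRoots_le_card_posRoots_add_one Φ (τe * 𝒦 * E) hne ψ ψ' ?_ ?_ ?_
  · -- zeros of ψ = roots of Φ
    intro x hx
    have hsq : Real.sqrt (S x) ≠ 0 := (Real.sqrt_pos.2 (hSpos x hx)).ne'
    simp only [hψ, hN, div_eq_zero_iff, IsRoot.def]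
    exact ⟨fun h => h.resolve_right hsq, fun h => Or.inl h⟩
  · -- derivative
    intro x hx
    have hNd : HasDerivAt N (N' x) x := by simp only [hN, hN']; exact Φ.hasDerivAt x
    have hτd : HasDerivAt (fun x => τe.eval x) (τe.derivative.eval x) x := τe.hasDerivAt x
    have hGd : HasDerivAt G (G' x) x := by
      simp only [hG, hG']
      refine ((hasDerivAt_pow (4 * e) x).mul (hτd.fun_pow 4)).congr_deriv ?_
      push_cast
      ring
    have hSd : HasDerivAt S (S' x) x := by
      simp only [hS, hS']
      refine ((hNd.fun_pow 2).add hGd).congr_deriv ?_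
      push_cast
      ring
    have hsqrt : HasDerivAt (fun x => Real.sqrt (S x)) (S' x / (2 * Real.sqrt (S x))) x := hSd.sqrt (hSpos x hx).ne'
    have hsq : Real.sqrt (S x) ≠ 0 := (Real.sqrt_pos.2 (hSpos x hx)).ne'
    simp only [hψ, hψ']
    exact hNd.div hsqrt hsq
  · -- critical points are roots of τe * 𝒦 * E
    intro c hc h0
    have hSc := hSpos c hc
    have hsq : Real.sqrt (S c) ≠ 0 := (Real.sqrt_pos.2 hSc).ne'
    have hsq2 : Real.sqrt (S c) ^ 2 = S c := Real.sq_sqrt hSc.le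
    rw [IsRoot.def, eval_mul, eval_mul]
    by_cases hτ0 : τe.eval c = 0
    · rw [hτ0]; ring
    -- numerator of ψ′ vanishes: 2 N′ S − N S′ = 0, i.e. 2 N′ G − N G′ = 0
    have hnum : N' c * Real.sqrt (S c) - N c * (S' c / (2 * Real.sqrt (S c))) = 0 := by
      have := h0
      simp only [hψ'] at this
      rcases div_eq_zero_iff.1 this with h | h
      · exact h
      · exfalso; exact pow_ne_zero 2 hsq h
    have hnum2 : 2 * N' c * S c - N c * S' c = 0 := by
      have h1 : (N' c * Real.sqrt (S c) - N c * (S' c / (2 * Real.sqrt (S c)))) * (2 * Real.sqrt (S c)) = 0 := by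
        rw [hnum, zero_mul]
      have h2 : (N' c * Real.sqrt (S c) - N c * (S' c / (2 * Real.sqrt (S c)))) * (2 * Real.sqrt (S c))
          = 2 * N' c * (Real.sqrt (S c)) ^ 2 - N c * S' c := by
        field_simp
      rw [h2, hsq2] at h1
      exact h1
    have hnum3 : 2 * N' c * G c - N c * G' c = 0 := by
      have : 2 * N' c * S c - N c * S' c = 2 * N' c * G c - N c * G' c := by
        simp only [hS, hS']
        ring
      rw [← this]; exact hnum2
    -- expand G, G′ and multiply by c
    have hpow := mul_pow_pred_eq c e
    have hkey : 2 * c ^ (4 * e) * (τe.eval c) ^ 3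
        * ((c * Φ.derivative.eval c - 4 * e * Φ.eval c) * τe.eval c - 2 * τee.eval c * Φ.eval c) = 0 := by
      have hτee' : τee.eval c = c * τe.derivative.eval c - e * τe.eval c := by
        rw [hτee]; simp only [eval_sub, eval_mul, eval_X, eval_C]
      have h1 : c * (2 * N' c * G c - N c * G' c) = 0 := by rw [hnum3, mul_zero]
      have h2 : c * (2 * N' c * G c - N c * G' c)
          = 2 * c ^ (4 * e) * (τe.eval c) ^ 3
            * ((c * Φ.derivative.eval c - 4 * e * Φ.eval c) * τe.eval c - 2 * τee.eval c * Φ.eval c) := by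
        simp only [hN, hN', hG, hG']
        rw [hτee']
        linear_combination (-(Φ.eval c) * (τe.eval c) ^ 4) * hpow
      rw [h2] at h1; exact h1
    have hc4 : 2 * c ^ (4 * e) * (τe.eval c) ^ 3 ≠ 0 := by positivity
    have hbr : (c * Φ.derivative.eval c - 4 * e * Φ.eval c) * τe.eval c - 2 * τee.eval c * Φ.eval c = 0 :=
      (mul_eq_zero.1 hkey).resolve_left hc4
    rw [euler_criticalPoly_mul_sub δ e τ π τe πe τee πee Φ 𝒦 E hτe hπe hτee hπee hΦ h𝒦 hE c] at hbr
    rw [mul_assoc, hbr, mul_zero]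

/-- Root bookkeeping: the distinct positive roots of a triple product number at most the sum over the factors. [folklore] -/
theorem card_posRoots_mul3_le (p q r : ℝ[X]) (h : p * q * r ≠ 0) :
    ((p * q * r).roots.toFinset.filter (fun t => 0 < t)).card
      ≤ (p.roots.toFinset.filter (fun t => 0 < t)).card + (q.roots.toFinset.filter (fun t => 0 < t)).card
        + (r.roots.toFinset.filter (fun t => 0 < t)).card := by
  classical
  have hpq : p * q ≠ 0 := left_ne_zero_of_mul h
  rw [roots_mul h, roots_mul hpq, Multiset.toFinset_add, Multiset.toFinset_add, filter_union, filter_union]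
  exact (Finset.card_union_le _ _).trans (Nat.add_le_add_right (Finset.card_union_le _ _) _)

/-- **CURVATURE REDUCTION FOR THE ROOT COUNT.**  In the setting of `card_posRoots_le_one_add_of_resolvent` (a `2 × 2` pivot pencil with
`det J = −δ < 0`: `f(x) = −δx^{2e} + τ(x)x^e + π(x)`, `π ≥ 0`, `τ² + 4δπ > 0` on `(0, ∞)`), if `Φ` and `τ_e` have no common positive root and
`τ_e·𝒦·E ≠ 0`, then **`Z₊(f) ≤ Z₊(τ_e) + Z₊(𝒦) + Z₊(E) + 2`**. [this file + `…PivotResolventRolle`] -/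
theorem card_posRoots_le_curvature_count (δ : ℝ) (e : ℕ) (τ π f τe πe τee πee Φ 𝒦 E : ℝ[X]) (hδ : 0 < δ)
    (hπ : ∀ x, 0 < x → 0 ≤ π.eval x) (hdisc : ∀ x, 0 < x → 0 < (τ.eval x) ^ 2 + 4 * δ * π.eval x)
    (hf : ∀ x, 0 < x → f.eval x = -δ * (x ^ e) ^ 2 + τ.eval x * x ^ e + π.eval x)
    (hτe : τe = X * derivative τ - Polynomial.C (e : ℝ) * τ) (hπe : πe = X * derivative π - Polynomial.C (2 * (e : ℝ)) * π)
    (hτee : τee = X * derivative τe - Polynomial.C (e : ℝ) * τe) (hπee : πee = X * derivative πe - Polynomial.C (2 * (e : ℝ)) * πe)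
    (hΦ : Φ = Polynomial.C δ * πe ^ 2 + τ * τe * πe - π * τe ^ 2) (h𝒦 : 𝒦 = τe * πee - τee * πe)
    (hE : E = Polynomial.C (2 * δ) * πe + τ * τe)
    (hgen : ∀ x, 0 < x → τe.eval x = 0 → Φ.eval x ≠ 0) (hne : τe * 𝒦 * E ≠ 0) :
    (f.roots.toFinset.filter (fun t => 0 < t)).card
      ≤ (τe.roots.toFinset.filter (fun t => 0 < t)).card + (𝒦.roots.toFinset.filter (fun t => 0 < t)).card
        + (E.roots.toFinset.filter (fun t => 0 < t)).card + 2 := by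
  have hΦne : Φ ≠ 0 := by
    -- `Φ = 0` would force `𝒦·E = 0` pointwise by the curvature identity, contradicting `τ_e·𝒦·E ≠ 0`
    intro h0
    apply hne
    have hKE : 𝒦 * E = 0 := by
      apply Polynomial.funext
      intro x
      have := euler_criticalPoly_mul_sub δ e τ π τe πe τee πee Φ 𝒦 E hτe hπe hτee hπee hΦ h𝒦 hE x
      rw [h0] at this
      simp only [derivative_zero, eval_zero, mul_zero, sub_zero, zero_mul] at this
      rw [eval_mul, eval_zero]
      exact this.symm
    rw [mul_assoc, hKE, mul_zero]
  have h1 := card_posRoots_le_one_add_of_resolvent δ e τ π f hδ hπ hdisc hf (by rw [← hπe, ← hτe, ← hΦ]; exact hΦne)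
  rw [← hπe, ← hτe, ← hΦ] at h1
  have h2 := card_posRoots_criticalPoly_le_curvature δ e τ π τe πe τee πee Φ 𝒦 E hτe hπe hτee hπee hΦ h𝒦 hE hgen hne
  have h3 := card_posRoots_mul3_le τe 𝒦 E hne
  omega

end Summit.ValiantsHypothesis.ValiantsHypothesis.Theorems.LacunarySymmetroidMatrixDescartes.Pivot.Resolvent
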